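import Summits.FinalStateConjecture.FinalStateConjecture.Theorems.PhotonSphereChannelsEndVisibleOuterRegion
import Summits.FinalStateConjecture.FinalStateConjecture.Theorems.PhotonSphereChannelsChannelsResolveTameDevelopmentsRRayClauseSplit
import HarnessLib

/-!
# Route PhotonSphereChannels · crux `ChannelsResolveTameDevelopmentsR` (K2R-T2, stmt-FinalStateConjecture-17430),
# line `dark-future-exactness`, stub C (`stub_settledExteriorHoldsRays` = item stmt-FinalStateConjecture-17673
# `SettledExteriorHoldsRays` VERBATIM, the DOCK of the ray-closure clause (C)):
# the dock in SET form, and the NARROW dock — the crux consumes only the chart-free half of item 17673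

Stub C of the line is not new mathematics of the line: it is the cross-route item
`SettledExteriorHoldsRays` (stmt-17673; `Theses.TangentConeAtIPlus` rank 6 / `Theses.RaychaudhuriBlowdown`
rank 6) verbatim, onto which the landed split `RayClause.channelsResolveTameDevelopmentsR_of_rayClause`
(`…RRayClauseSplit`, p137580/p137749: K2R-T2 ⇐ K2R♭ ∧ 17673) docks clause (C) `RaysStayInClosure`.
The item is OPEN (own skeleton `Cruxes/SettledExteriorHoldsRays/Lines/birth.lean`, stubs
S `stub_chartsShadowEndVisibleRegion` — chart side: `endVisibleRegion 𝒟 ∩ J⁺(ι X) ⊆ exteriorOf 𝒟 fd.charted`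
for EVERY honest `fd` — and N `stub_noHiddenCompleteRays` — interior/topology side, chart-free:
`EndVisible.CompleteRaysNearEndVisible 𝒟`; refuter verdict: survives the basic attacks, one live
operator-level exposure on `Σ = ℝ³ # N` (hidden expanding bag), `CruxAttack17673.md`).

This file records three kernel-checked facts about the dock, over landed vocabulary only
(`Theorems/PhotonSphereChannelsEndVisibleDefs`, `…EndVisibleOuterRegion`, `…RRayClauseSplit`):

* §1 `settledExteriorHoldsRays_iff_outerRegion_subset` — **the dock in set form**: the body of item
  17673 (left side, verbatim the registered signature of stub C) is equivalent to "for every admissible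
  datum, every MGHD with complete `𝓘⁺` and every sub-extremal honest exhaustive future-oriented
  `2`-decomposition `fd` of `O`, the future domain of outer communications lies in `O`:
  `TrappedSet.outerRegion 𝒟 ⊆ O`" — closure-free (outer-region adherence,
  `EndVisible.raysStayInClosure_exteriorOf_iff_outerRegion_subset`, per development). Previously checked
  only inside a crux workfile (`Cruxes/…/Lines/Sketch.lean` §3c); here importable.
* §2 per development — `raysStayInClosure_of_endVisibleShadow_of_completeRaysNearEndVisible`
  (S at `(𝒟, O)` ∧ N at `𝒟` ⇒ (C) at `(𝒟, O)`, the item's own cut pointwise) and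
  `settleConjunct_of_noHiddenAt_of_settlesEndVisibly` / `…_of_endVisibleShadow`: at ONE development
  satisfying hypothesis (i), the summit's full T2 settle conjunct follows from an honest decomposition
  that settles END-VISIBLY (`EndVisible.SettlesEndVisibly 𝒟`: (C) weakened to C_end, resp. the set form
  `endVisibleRegion ∩ J⁺(ι X) ⊆ O`) together with the instance AT `𝒟` of stub N of item 17673 only.
* §3 `channelsResolveTameDevelopmentsR_of_noHidden_of_settlesEndVisibly` — **the narrow dock**: K2R-T2
  follows from (a) K2R_end (the crux with (C) weakened to C_end — what an honest endgame delivers for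
  ITS OWN decomposition, e.g. via `EndVisible.endVisibleRaysStayInClosure_of_farRaysShadowedBy`) and
  (b) hypothesis `hN` = LITERALLY the registered signature of stub `stub_noHiddenCompleteRays` of item
  17673 (chart-free NoHidden for developments admitting an honest sub-extremal exhaustive future-oriented
  decomposition). So of the two halves S ∧ N of item 17673 the crux consumes N only: the chart-side half
  S (about ARBITRARY honest decompositions, size L on the item's card) is a burden the verbatim dock
  imports but the crux never inspects. The operator-level exposure (hidden bag) sits in N either way —
  the narrow dock is narrower in proof burden, not in truth value. `channelsResolveTameDevelopmentsR_of_noHidden_of_endVisibleShadow`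
  is the same with K2R_end in set form.

Nothing here restates a route item as a theorem; stub C itself stays open (= item 17673).

References: M. Dafermos, J. Luk, arXiv:1710.01722, Conjecture 1 and p. 10 (no interior claim);
S. W. Hawking, G. F. R. Ellis (1973), §9.2; B. O'Neill, *Semi-Riemannian geometry* (1983), Ch. 14,
Lemma 14.3 and Lemma 14.6.
-/

noncomputable section

-- `Summit.FinalStateConjecture.FinalStateConjecture.…` (summit = sub-problem) is the tree's layout
set_option linter.dupNamespace false

open Set Filter Topology
open scoped Manifold ContDiff
open Literature.Geometry.Lorentzian
open Summit.FinalStateConjecture.FinalStateConjecture.Theorems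

namespace Summit.FinalStateConjecture.FinalStateConjecture.Theorems.DarkFuture

/-! ## §1. The dock in set form -/

/-- **Item `SettledExteriorHoldsRays` (stmt-17673) = stub C of line `dark-future-exactness`, in SET FORM.**
Its body (left, verbatim the registered signature) is equivalent to: for every admissible datum, every
MGHD with complete `𝓘⁺` and every sub-extremal honest exhaustive future-oriented `2`-decomposition `fd`
of `O = exteriorOf 𝒟 fd.charted`, the future domain of outer communications
`outerRegion 𝒟 = J⁺(ι X) ∩ I⁻(all future-complete normalised null rays from Σ)` lies in `O` — i.e. the
chronological past of the charted late region swallows the whole d.o.c., hidden regions included.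
Per development this is `EndVisible.raysStayInClosure_exteriorOf_iff_outerRegion_subset` (push-up through
the open `I⁺(q)` one way, outer-region adherence the other). [cite: DafermosLuk2017, Conjecture 1] -/
theorem settledExteriorHoldsRays_iff_outerRegion_subset :
    (∀ (X : Type) [TopologicalSpace X] [ChartedSpace E3 X] [IsManifold (𝓡 3) ∞ X] [T2Space X]
      [SecondCountableTopology X] [ConnectedSpace X] (D : InitialDataSet (𝓡 3) X),
      D ∈ admissibleVacuumData X → ∀ 𝒟 : VacuumCauchyDevelopment D, 𝒟.IsMaximal →
      _root_.Summit.FinalStateConjecture.HasCompleteNullInfinity 𝒟.toCauchyDevelopment →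
      ∀ (O : Set 𝒟.carrier) (fd : FinalStateDecomposition 𝒟.toSpacetime O 2),
      (∀ i, Kerr.IsSubextremal (fd.mass i) (fd.spin i)) →
      O = _root_.Summit.FinalStateConjecture.exteriorOf 𝒟.toCauchyDevelopment fd.charted →
      _root_.Summit.FinalStateConjecture.HasExhaustiveCharts fd →
      _root_.Summit.FinalStateConjecture.IsFutureOriented fd →
      _root_.Summit.FinalStateConjecture.RaysStayInClosure 𝒟.toCauchyDevelopment O) ↔
    (∀ (X : Type) [TopologicalSpace X] [ChartedSpace E3 X] [IsManifold (𝓡 3) ∞ X] [T2Space X]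
      [SecondCountableTopology X] [ConnectedSpace X] (D : InitialDataSet (𝓡 3) X),
      D ∈ admissibleVacuumData X → ∀ 𝒟 : VacuumCauchyDevelopment D, 𝒟.IsMaximal →
      _root_.Summit.FinalStateConjecture.HasCompleteNullInfinity 𝒟.toCauchyDevelopment →
      ∀ (O : Set 𝒟.carrier) (fd : FinalStateDecomposition 𝒟.toSpacetime O 2),
      (∀ i, Kerr.IsSubextremal (fd.mass i) (fd.spin i)) →
      O = _root_.Summit.FinalStateConjecture.exteriorOf 𝒟.toCauchyDevelopment fd.charted →
      _root_.Summit.FinalStateConjecture.HasExhaustiveCharts fd →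
      _root_.Summit.FinalStateConjecture.IsFutureOriented fd →
      ∀ [𝒟.metric.HasLeviCivita], TrappedSet.outerRegion 𝒟.toCauchyDevelopment ⊆ O) := by
  constructor
  · intro h X _ _ _ _ _ _ D hD 𝒟 hmax hcomp O fd hsub hO hexh hfo _
    have hC : _root_.Summit.FinalStateConjecture.RaysStayInClosure 𝒟.toCauchyDevelopment O :=
      h X D hD 𝒟 hmax hcomp O fd hsub hO hexh hfo
    rw [hO] at hC ⊢
    exact (EndVisible.raysStayInClosure_exteriorOf_iff_outerRegion_subset
      (𝒟 := 𝒟.toCauchyDevelopment) fd.charted).1 hC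
  · intro h X _ _ _ _ _ _ D hD 𝒟 hmax hcomp O fd hsub hO hexh hfo
    rw [hO]
    refine (EndVisible.raysStayInClosure_exteriorOf_iff_outerRegion_subset
      (𝒟 := 𝒟.toCauchyDevelopment) fd.charted).2 ?_
    intro _
    rw [← hO]
    exact h X D hD 𝒟 hmax hcomp O fd hsub hO hexh hfo

/-! ## §2. Per development: what the crux consumes of the dock -/

section PerDevelopment

variable {X : Type} [TopologicalSpace X] [ChartedSpace E3 X] [IsManifold (𝓡 3) ∞ X]
  [ConnectedSpace X] {D : InitialDataSet (𝓡 3) X}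

/-- **The item's cut, pointwise: S at `(𝒟, O)` ∧ N at `𝒟` ⇒ (C) at `(𝒟, O)`.** If the end-visible
region to the causal future of the data lies in `O` and no future-complete normalised null ray from
`Σ` is hidden from the end (`CompleteRaysNearEndVisible 𝒟`), then every such ray stays in `closure O`:
N in set form gives `outerRegion ⊆ endVisibleRegion`
(`EndVisible.outerRegion_subset_endVisibleRegion_of_completeRaysNearEndVisible`), S maps its part in
`J⁺(ι X)` into `O`, and outer-region adherence + push-up
(`EndVisible.raysStayInClosure_of_outerRegion_subset_closure`) convert `outerRegion ⊆ O` into the ray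
clause. [cite: ONeillSemiRiemannian1983, Ch. 14, Lemma 14.6 (2)] -/
theorem raysStayInClosure_of_endVisibleShadow_of_completeRaysNearEndVisible {𝒟 : CauchyDevelopment D}
    {O : Set 𝒟.carrier}
    (hS : ∀ [𝒟.metric.HasLeviCivita],
      EndVisible.endVisibleRegion 𝒟 ∩ 𝒟.metric.causalFuture 𝒟.timeOrientation (range 𝒟.embed) ⊆ O)
    (hN : EndVisible.CompleteRaysNearEndVisible 𝒟) :
    _root_.Summit.FinalStateConjecture.RaysStayInClosure 𝒟 O :=
  EndVisible.raysStayInClosure_of_outerRegion_subset_closure fun {_} _ hq ↦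
    subset_closure
      (hS ⟨EndVisible.outerRegion_subset_endVisibleRegion_of_completeRaysNearEndVisible hN hq, hq.1⟩)

/-- **The T2 settle conjunct at one development from an END-VISIBLY settling decomposition and the
instance at `𝒟` of stub N of item 17673.** For a vacuum Cauchy development `𝒟` satisfying hypothesis
(i) (`TrappedSet.NoExtremalRemnant 𝒟`, which makes every `2`-decomposition sub-extremal,
`RayClause.isSubextremal_of_noExtremalRemnant`): if `𝒟` settles end-visibly
(`EndVisible.SettlesEndVisibly 𝒟`: an honest exhaustive future-oriented `d` of `O = exteriorOf 𝒟 d.charted`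
with C_end) and NoHidden holds at `𝒟` as soon as SOME sub-extremal honest exhaustive future-oriented
decomposition exists (hypothesis `hN`: the body of `stub_noHiddenCompleteRays` of item 17673 at `𝒟`),
then the summit's full settle conjunct holds at `𝒟` (same `O`, same `d`; glue
`EndVisible.raysStayInClosure_of_endVisible`). [cite: DafermosLuk2017, Conjecture 1] -/
theorem settleConjunct_of_noHiddenAt_of_settlesEndVisibly {𝒟 : VacuumCauchyDevelopment D}
    (hi : TrappedSet.NoExtremalRemnant 𝒟)
    (hN : ∀ (O : Set 𝒟.carrier) (fd : FinalStateDecomposition 𝒟.toSpacetime O 2),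
      (∀ i, Kerr.IsSubextremal (fd.mass i) (fd.spin i)) →
      O = _root_.Summit.FinalStateConjecture.exteriorOf 𝒟.toCauchyDevelopment fd.charted →
      _root_.Summit.FinalStateConjecture.HasExhaustiveCharts fd →
      _root_.Summit.FinalStateConjecture.IsFutureOriented fd →
      EndVisible.CompleteRaysNearEndVisible 𝒟.toCauchyDevelopment)
    (h : EndVisible.SettlesEndVisibly 𝒟) :
    ∃ (O : Set 𝒟.carrier) (d : FinalStateDecomposition 𝒟.toSpacetime O 2),
      (∀ i, Kerr.IsSubextremal (d.mass i) (d.spin i)) ∧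
      O = _root_.Summit.FinalStateConjecture.exteriorOf 𝒟.toCauchyDevelopment d.charted ∧
      _root_.Summit.FinalStateConjecture.RaysStayInClosure 𝒟.toCauchyDevelopment O ∧
      _root_.Summit.FinalStateConjecture.HasExhaustiveCharts d ∧
      _root_.Summit.FinalStateConjecture.IsFutureOriented d := by
  obtain ⟨O, d, hO, hC, hexh, hfo⟩ := h
  have hsub : ∀ i, Kerr.IsSubextremal (d.mass i) (d.spin i) :=
    ChannelsResolveTameDevelopmentsR.RayClause.isSubextremal_of_noExtremalRemnant hi d
  exact ⟨O, d, hsub, hO, EndVisible.raysStayInClosure_of_endVisible hC (hN O d hsub hO hexh hfo),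
    hexh, hfo⟩

/-- **Set-form variant.** As `settleConjunct_of_noHiddenAt_of_settlesEndVisibly`, with the end-visible
ray clause C_end of the decomposition replaced by the set inclusion
`endVisibleRegion 𝒟 ∩ J⁺(ι X) ⊆ O` (stub S of item 17673 AT the produced decomposition; for an honest
`O = exteriorOf 𝒟 d.charted` it is implied by `EndVisible.FarRaysShadowedBy 𝒟 d.charted` through
`EndVisible.endVisibleRegion_inter_causalFuture_subset_exteriorOf`). [cite: DafermosLuk2017, Conjecture 1] -/
theorem settleConjunct_of_noHiddenAt_of_endVisibleShadow {𝒟 : VacuumCauchyDevelopment D}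
    (hi : TrappedSet.NoExtremalRemnant 𝒟)
    (hN : ∀ (O : Set 𝒟.carrier) (fd : FinalStateDecomposition 𝒟.toSpacetime O 2),
      (∀ i, Kerr.IsSubextremal (fd.mass i) (fd.spin i)) →
      O = _root_.Summit.FinalStateConjecture.exteriorOf 𝒟.toCauchyDevelopment fd.charted →
      _root_.Summit.FinalStateConjecture.HasExhaustiveCharts fd →
      _root_.Summit.FinalStateConjecture.IsFutureOriented fd →
      EndVisible.CompleteRaysNearEndVisible 𝒟.toCauchyDevelopment)
    (h : ∃ (O : Set 𝒟.carrier) (d : FinalStateDecomposition 𝒟.toSpacetime O 2),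
      O = _root_.Summit.FinalStateConjecture.exteriorOf 𝒟.toCauchyDevelopment d.charted ∧
      (∀ [𝒟.metric.HasLeviCivita], EndVisible.endVisibleRegion 𝒟.toCauchyDevelopment ∩
        𝒟.metric.causalFuture 𝒟.timeOrientation (range 𝒟.embed) ⊆ O) ∧
      _root_.Summit.FinalStateConjecture.HasExhaustiveCharts d ∧
      _root_.Summit.FinalStateConjecture.IsFutureOriented d) :
    ∃ (O : Set 𝒟.carrier) (d : FinalStateDecomposition 𝒟.toSpacetime O 2),
      (∀ i, Kerr.IsSubextremal (d.mass i) (d.spin i)) ∧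
      O = _root_.Summit.FinalStateConjecture.exteriorOf 𝒟.toCauchyDevelopment d.charted ∧
      _root_.Summit.FinalStateConjecture.RaysStayInClosure 𝒟.toCauchyDevelopment O ∧
      _root_.Summit.FinalStateConjecture.HasExhaustiveCharts d ∧
      _root_.Summit.FinalStateConjecture.IsFutureOriented d := by
  obtain ⟨O, d, hO, hS, hexh, hfo⟩ := h
  have hsub : ∀ i, Kerr.IsSubextremal (d.mass i) (d.spin i) :=
    ChannelsResolveTameDevelopmentsR.RayClause.isSubextremal_of_noExtremalRemnant hi d
  exact ⟨O, d, hsub, hO,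
    raysStayInClosure_of_endVisibleShadow_of_completeRaysNearEndVisible (𝒟 := 𝒟.toCauchyDevelopment)
      (fun {_} ↦ hS) (hN O d hsub hO hexh hfo),
    hexh, hfo⟩

end PerDevelopment

/-! ## §3. The narrow dock: K2R_end ∧ (stub N of item 17673) ⇒ K2R-T2 -/

/-- **The narrow dock (ray form).** The crux `ChannelsResolveTameDevelopmentsR` (K2R-T2) follows from
(a) hypothesis `hN` — LITERALLY the registered signature of stub `stub_noHiddenCompleteRays` of item
`SettledExteriorHoldsRays` (stmt-17673): for every admissible datum, every MGHD with complete `𝓘⁺`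
admitting a sub-extremal honest exhaustive future-oriented `2`-decomposition, no future-complete
normalised null ray from `Σ` is hidden from the end — and (b) K2R_end: the crux with clause (C)
weakened to C_end (`EndVisible.SettlesEndVisibly`), hypotheses byte-identical (K1R, admissible `D`,
maximal `𝒟`, complete `𝓘⁺`, (i) ∧ (ii)). Compare `RayClause.channelsResolveTameDevelopmentsR_of_rayClause`
(K2R♭ ∧ the WHOLE item 17673 ⇒ K2R-T2): the chart-side half S of the item (about arbitrary honest
decompositions) is replaced by C_end for the ONE decomposition the resolution builds.
[cite: DafermosLuk2017, Conjecture 1] -/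
theorem channelsResolveTameDevelopmentsR_of_noHidden_of_settlesEndVisibly
    (hN : ∀ (X : Type) [TopologicalSpace X] [ChartedSpace E3 X] [IsManifold (𝓡 3) ∞ X] [T2Space X]
      [SecondCountableTopology X] [ConnectedSpace X] (D : InitialDataSet (𝓡 3) X),
      D ∈ admissibleVacuumData X → ∀ 𝒟 : VacuumCauchyDevelopment D, 𝒟.IsMaximal →
      _root_.Summit.FinalStateConjecture.HasCompleteNullInfinity 𝒟.toCauchyDevelopment →
      ∀ (O : Set 𝒟.carrier) (fd : FinalStateDecomposition 𝒟.toSpacetime O 2),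
      (∀ i, Kerr.IsSubextremal (fd.mass i) (fd.spin i)) →
      O = _root_.Summit.FinalStateConjecture.exteriorOf 𝒟.toCauchyDevelopment fd.charted →
      _root_.Summit.FinalStateConjecture.HasExhaustiveCharts fd →
      _root_.Summit.FinalStateConjecture.IsFutureOriented fd →
      EndVisible.CompleteRaysNearEndVisible 𝒟.toCauchyDevelopment)
    (hEnd : _root_.Summit.FinalStateConjecture.FinalStateConjecture.Theses.PhotonSphereChannels.UniformPhotonSphereChannelsR →
      ∀ (X : Type) [TopologicalSpace X] [ChartedSpace E3 X] [IsManifold (𝓡 3) ∞ X] [T2Space X]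
      [SecondCountableTopology X] [ConnectedSpace X], ∀ D ∈ admissibleVacuumData X,
      ∀ 𝒟 : VacuumCauchyDevelopment D, 𝒟.IsMaximal →
      _root_.Summit.FinalStateConjecture.HasCompleteNullInfinity 𝒟.toCauchyDevelopment →
      (TrappedSet.NoExtremalRemnant 𝒟 ∧ TrappedSet.TameOuterRegion 𝒟) →
      EndVisible.SettlesEndVisibly 𝒟) :
    _root_.Summit.FinalStateConjecture.FinalStateConjecture.Theses.PhotonSphereChannels.ChannelsResolveTameDevelopmentsR := by
  intro h₁ X _ _ _ _ _ _ D hD 𝒟 hmax hcomp hyp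
  obtain ⟨O, d, -, hO, hC, hexh, hfo⟩ := settleConjunct_of_noHiddenAt_of_settlesEndVisibly hyp.1
    (hN X D hD 𝒟 hmax hcomp) (hEnd h₁ X D hD 𝒟 hmax hcomp hyp)
  exact ⟨O, d, hO, hC, hexh, hfo⟩

/-- **Registered sub-goal `stub_settledExteriorHoldsRays_narrowDock` of stmt-FinalStateConjecture-17430** (header on one
line = the registered signature; = `channelsResolveTameDevelopmentsR_of_noHidden_of_settlesEndVisibly`): the crux from
stub N of item 17673 (verbatim) and K2R_end. [cite: DafermosLuk2017, Conjecture 1] -/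
theorem stub_settledExteriorHoldsRays_narrowDock : (∀ (X : Type) [TopologicalSpace X] [ChartedSpace E3 X] [IsManifold (𝓡 3) ∞ X] [T2Space X] [SecondCountableTopology X] [ConnectedSpace X] (D : InitialDataSet (𝓡 3) X), D ∈ admissibleVacuumData X → ∀ 𝒟 : VacuumCauchyDevelopment D, 𝒟.IsMaximal → _root_.Summit.FinalStateConjecture.HasCompleteNullInfinity 𝒟.toCauchyDevelopment → ∀ (O : Set 𝒟.carrier) (fd : FinalStateDecomposition 𝒟.toSpacetime O 2), (∀ i, Kerr.IsSubextremal (fd.mass i) (fd.spin i)) → O = _root_.Summit.FinalStateConjecture.exteriorOf 𝒟.toCauchyDevelopment fd.charted → _root_.Summit.FinalStateConjecture.HasExhaustiveCharts fd → _root_.Summit.FinalStateConjecture.IsFutureOriented fd → EndVisible.CompleteRaysNearEndVisible 𝒟.toCauchyDevelopment) → (_root_.Summit.FinalStateConjecture.FinalStateConjecture.Theses.PhotonSphereChannels.UniformPhotonSphereChannelsR → ∀ (X : Type) [TopologicalSpace X] [ChartedSpace E3 X] [IsManifold (𝓡 3) ∞ X] [T2Space X] [SecondCountableTopology X] [ConnectedSpace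 X], ∀ D ∈ admissibleVacuumData X, ∀ 𝒟 : VacuumCauchyDevelopment D, 𝒟.IsMaximal → _root_.Summit.FinalStateConjecture.HasCompleteNullInfinity 𝒟.toCauchyDevelopment → (TrappedSet.NoExtremalRemnant 𝒟 ∧ TrappedSet.TameOuterRegion 𝒟) → EndVisible.SettlesEndVisibly 𝒟) → _root_.Summit.FinalStateConjecture.FinalStateConjecture.Theses.PhotonSphereChannels.ChannelsResolveTameDevelopmentsR :=
  fun hN hEnd ↦ channelsResolveTameDevelopmentsR_of_noHidden_of_settlesEndVisibly hN hEnd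

/-- **The narrow dock (set form).** As `channelsResolveTameDevelopmentsR_of_noHidden_of_settlesEndVisibly`,
with K2R_end in set form: the resolution delivers an honest exhaustive future-oriented `d` whose settled
region `O = exteriorOf 𝒟 d.charted` contains the END-VISIBLE part of `J⁺(ι X)` (stub S of item 17673 at
the produced decomposition only). [cite: DafermosLuk2017, Conjecture 1] -/
theorem channelsResolveTameDevelopmentsR_of_noHidden_of_endVisibleShadow
    (hN : ∀ (X : Type) [TopologicalSpace X] [ChartedSpace E3 X] [IsManifold (𝓡 3) ∞ X] [T2Space X]
      [SecondCountableTopology X] [ConnectedSpace X] (D : InitialDataSet (𝓡 3) X),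
      D ∈ admissibleVacuumData X → ∀ 𝒟 : VacuumCauchyDevelopment D, 𝒟.IsMaximal →
      _root_.Summit.FinalStateConjecture.HasCompleteNullInfinity 𝒟.toCauchyDevelopment →
      ∀ (O : Set 𝒟.carrier) (fd : FinalStateDecomposition 𝒟.toSpacetime O 2),
      (∀ i, Kerr.IsSubextremal (fd.mass i) (fd.spin i)) →
      O = _root_.Summit.FinalStateConjecture.exteriorOf 𝒟.toCauchyDevelopment fd.charted →
      _root_.Summit.FinalStateConjecture.HasExhaustiveCharts fd →
      _root_.Summit.FinalStateConjecture.IsFutureOriented fd →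
      EndVisible.CompleteRaysNearEndVisible 𝒟.toCauchyDevelopment)
    (hEnd : _root_.Summit.FinalStateConjecture.FinalStateConjecture.Theses.PhotonSphereChannels.UniformPhotonSphereChannelsR →
      ∀ (X : Type) [TopologicalSpace X] [ChartedSpace E3 X] [IsManifold (𝓡 3) ∞ X] [T2Space X]
      [SecondCountableTopology X] [ConnectedSpace X], ∀ D ∈ admissibleVacuumData X,
      ∀ 𝒟 : VacuumCauchyDevelopment D, 𝒟.IsMaximal →
      _root_.Summit.FinalStateConjecture.HasCompleteNullInfinity 𝒟.toCauchyDevelopment →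
      (TrappedSet.NoExtremalRemnant 𝒟 ∧ TrappedSet.TameOuterRegion 𝒟) →
      ∃ (O : Set 𝒟.carrier) (d : FinalStateDecomposition 𝒟.toSpacetime O 2),
        O = _root_.Summit.FinalStateConjecture.exteriorOf 𝒟.toCauchyDevelopment d.charted ∧
        (∀ [𝒟.metric.HasLeviCivita], EndVisible.endVisibleRegion 𝒟.toCauchyDevelopment ∩
          𝒟.metric.causalFuture 𝒟.timeOrientation (range 𝒟.embed) ⊆ O) ∧
        _root_.Summit.FinalStateConjecture.HasExhaustiveCharts d ∧
        _root_.Summit.FinalStateConjecture.IsFutureOriented d) :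
    _root_.Summit.FinalStateConjecture.FinalStateConjecture.Theses.PhotonSphereChannels.ChannelsResolveTameDevelopmentsR := by
  intro h₁ X _ _ _ _ _ _ D hD 𝒟 hmax hcomp hyp
  obtain ⟨O, d, -, hO, hC, hexh, hfo⟩ := settleConjunct_of_noHiddenAt_of_endVisibleShadow hyp.1
    (hN X D hD 𝒟 hmax hcomp) (hEnd h₁ X D hD 𝒟 hmax hcomp hyp)
  exact ⟨O, d, hO, hC, hexh, hfo⟩

/-- **The verbatim dock implies the chart-side half S at every honest decomposition** (so S is the
conjunct the verbatim dock carries in excess of what §3 consumes): from the body of item 17673, for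
every admissible datum, MGHD with complete `𝓘⁺` and sub-extremal honest exhaustive future-oriented `fd`,
`endVisibleRegion 𝒟 ∩ J⁺(ι X) ⊆ exteriorOf 𝒟 fd.charted` — because the end-visible region to the future
of the data lies in the outer region (`EndVisible.endVisibleRegion_inter_causalFuture_subset_outerRegion`)
and the dock in set form (§1) puts the outer region inside `O = exteriorOf 𝒟 fd.charted`.
[cite: HawkingEllis1973, §9.2] -/
theorem endVisibleShadow_of_settledExteriorHoldsRays
    (hC : ∀ (X : Type) [TopologicalSpace X] [ChartedSpace E3 X] [IsManifold (𝓡 3) ∞ X] [T2Space X]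
      [SecondCountableTopology X] [ConnectedSpace X] (D : InitialDataSet (𝓡 3) X),
      D ∈ admissibleVacuumData X → ∀ 𝒟 : VacuumCauchyDevelopment D, 𝒟.IsMaximal →
      _root_.Summit.FinalStateConjecture.HasCompleteNullInfinity 𝒟.toCauchyDevelopment →
      ∀ (O : Set 𝒟.carrier) (fd : FinalStateDecomposition 𝒟.toSpacetime O 2),
      (∀ i, Kerr.IsSubextremal (fd.mass i) (fd.spin i)) →
      O = _root_.Summit.FinalStateConjecture.exteriorOf 𝒟.toCauchyDevelopment fd.charted →
      _root_.Summit.FinalStateConjecture.HasExhaustiveCharts fd →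
      _root_.Summit.FinalStateConjecture.IsFutureOriented fd →
      _root_.Summit.FinalStateConjecture.RaysStayInClosure 𝒟.toCauchyDevelopment O) :
    ∀ (X : Type) [TopologicalSpace X] [ChartedSpace E3 X] [IsManifold (𝓡 3) ∞ X] [T2Space X]
      [SecondCountableTopology X] [ConnectedSpace X] (D : InitialDataSet (𝓡 3) X),
      D ∈ admissibleVacuumData X → ∀ 𝒟 : VacuumCauchyDevelopment D, 𝒟.IsMaximal →
      _root_.Summit.FinalStateConjecture.HasCompleteNullInfinity 𝒟.toCauchyDevelopment →
      ∀ (O : Set 𝒟.carrier) (fd : FinalStateDecomposition 𝒟.toSpacetime O 2),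
      (∀ i, Kerr.IsSubextremal (fd.mass i) (fd.spin i)) →
      O = _root_.Summit.FinalStateConjecture.exteriorOf 𝒟.toCauchyDevelopment fd.charted →
      _root_.Summit.FinalStateConjecture.HasExhaustiveCharts fd →
      _root_.Summit.FinalStateConjecture.IsFutureOriented fd →
      ∀ [𝒟.metric.HasLeviCivita], EndVisible.endVisibleRegion 𝒟.toCauchyDevelopment ∩
        𝒟.metric.causalFuture 𝒟.timeOrientation (range 𝒟.embed) ⊆
          _root_.Summit.FinalStateConjecture.exteriorOf 𝒟.toCauchyDevelopment fd.charted := by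
  intro X _ _ _ _ _ _ D hD 𝒟 hmax hcomp O fd hsub hO hexh hfo _ q hq
  have hdoc := settledExteriorHoldsRays_iff_outerRegion_subset.1 hC X D hD 𝒟 hmax hcomp O fd hsub hO
    hexh hfo
  rw [hO] at hdoc
  exact hdoc (EndVisible.endVisibleRegion_inter_causalFuture_subset_outerRegion hq)

end Summit.FinalStateConjecture.FinalStateConjecture.Theorems.DarkFuture

end
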